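import Literature.NumberTheory.Automorphic.UnramifiedIntegralConjugacy
import Literature.NumberTheory.Automorphic.UnramifiedOrbitSetAdelic
import HarnessLib

/-!
# Kottwitz's Prop. 7.1 in the `K_v`-conjugacy form WITHOUT a rational reference: two integral elements with the same separable
# characteristic polynomial `p ⊗ 1` are `K_v`-conjugate, at almost every place depending only on `(J, p)`
(Kottwitz, *Stable trace formula: elliptic singular terms* (1986), Prop. 7.1, Cor. 7.3; Rogawski, *Automorphic Representations of Unitary
Groups in Three Variables* (1990), §3.3 p. 21)

Topic `NumberTheory/Automorphic`; namespace `Literature.NumberTheory.Automorphic.UnitaryGroup`; THEOREMS ONLY (no definition, no instance, no named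
fact, no `sorry`).  ★ `UnramifiedIntegralConjugacy` (`eventually_forall_integralConj`) is stated at the diagonal image `γ ⊗ 1` of a RATIONAL
`γ ∈ GL_N(E)` lying in `U(J)(F_v)` at every `v`.  The stable ∕ `κ`-orbital sums of the comparison run over ADELIC classes matching a rational element of
ANOTHER form (★ `Rogawski1990.MatchingAdele`, `adelicStableClassesOver`), whose classes need not contain a rational point of `U(J)`; what two matching
components `g, g′ ∈ U(J)(F_v)` share is ONE separable characteristic polynomial `p ⊗ 1`, `p ∈ E[X]` (★ `Corresponds.charpoly_eq`).  Kottwitz's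
hypotheses are local, so the same proof gives the RELATIVE statement: for all but finitely many `v` — the exceptional set depending only on `J` and
`p` (ramified places, `J_w ∉ GL_N(𝒪_w)`, no integral model of `p` separable modulo `𝔪_w`) — any two `g, g′ ∈ K_v = U(J)(𝒪_v)` with
`charpoly g = charpoly g′ = p ⊗ 1` are conjugate by an element of `K_v`.

## Main statements
* §1 `exists_mem_glInt_conj_eq_of_charpoly_eq` — `GL_N(𝒪_w)`-conjugacy of two integral elements of `GL_N(E_w)` with the same characteristic polynomial
  admitting an integral model separable modulo `𝔪_w` (★ F1 `exists_isUnit_det_conj_of_charpoly_eq` on the integral lifts).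
* §2 `integralConj_of_split_of_mem` ∕ `integralConj_of_nonsplit_of_mem` — the one-place statements for two elements of `U(J)(𝒪_v)` (split: §1 along ★
  `localSplitEquiv`; non-split unramified: ★ `integralConj_unitaryGroupOfForm` along ★ `localNonsplitEquiv`).
* §3 **`eventually_forall_integralConj_of_charpoly_eq`** — `∀ᶠ v, ∀ g g′ ∈ U(J)(𝒪_v), charpoly g = p ⊗ 1 → charpoly g′ = p ⊗ 1 → ∃ k ∈ U(J)(𝒪_v),
  k g k⁻¹ = g′`; CM dress `eventually_forall_integralConj_cmDatum_of_charpoly_eq` on ★ `cmDatum`.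

## References
* R. E. Kottwitz, *Stable trace formula: elliptic singular terms*, Math. Ann. 275 (1986), §7, Prop. 7.1, Cor. 7.3 [Kottwitz1986].
* J. D. Rogawski, *Automorphic Representations of Unitary Groups in Three Variables*, Ann. of Math. Stud. 123 (1990), §3.3 p. 21 [Rogawski1990].
* J.-P. Serre, *Local Fields*, GTM 67 (1979), Ch. III §5 Thm. 1 (ramified primes divide the different) [Serre1979].
-/

set_option autoImplicit false

noncomputable section

open NumberField IsDedekindDomain Filter Polynomial
open scoped Matrix Pointwise

namespace Literature.NumberTheory.Automorphic

/-! ## §1 `GL_N(𝒪_w)`-conjugacy of two integral elements -/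

section GLCore

variable {E : Type} [Field E] [NumberField E] (N : ℕ)

/-- **Integral conjugacy in `GL_N(E_w)`** ([Kt₄] Prop. 7.1 for `GL_N`, conjugacy form, no rational reference): two elements `γ_w, y_w ∈ GL_N(𝒪_w)`
(★ `glInt`) with the SAME characteristic polynomial, which admits an integral model separable modulo `𝔪_w`, satisfy `k γ_w k⁻¹ = y_w` for some
`k ∈ GL_N(𝒪_w)` — ★ F1 `exists_isUnit_det_conj_of_charpoly_eq` on the integral lifts (★ `mem_range_map_adicCompletionIntegers_iff_mem_glInt`).
(Lemma and proof drafted by the HCML F0∕P3a seat p02, report-first 34eb533c §2.) [cite: Kottwitz1986, Prop. 7.1] -/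
theorem exists_mem_glInt_conj_eq_of_charpoly_eq (w : HeightOneSpectrum (𝓞 E)) (γw yw : GL (Fin N) (w.adicCompletion E))
    (hγ : γw ∈ glInt N (w.adicCompletion E)) (hy : yw ∈ glInt N (w.adicCompletion E))
    (hsep : ∃ q : (w.adicCompletionIntegers E)[X],
      q.map (w.adicCompletionIntegers E).subtype = ((γw : GL (Fin N) (w.adicCompletion E)) : Matrix (Fin N) (Fin N) (w.adicCompletion E)).charpoly ∧
        (q.map (IsLocalRing.residue (w.adicCompletionIntegers E))).Separable)
    (hchar : ((yw : GL (Fin N) (w.adicCompletion E)) : Matrix (Fin N) (Fin N) (w.adicCompletion E)).charpoly =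
      ((γw : GL (Fin N) (w.adicCompletion E)) : Matrix (Fin N) (Fin N) (w.adicCompletion E)).charpoly) :
    ∃ k ∈ glInt N (w.adicCompletion E), k * γw * k⁻¹ = yw := by
  have hfinj : Function.Injective (w.adicCompletionIntegers E).subtype := Subtype.val_injective
  -- integral lifts `γ̃`, `ỹ`
  obtain ⟨γu, hγu⟩ := (mem_range_map_adicCompletionIntegers_iff_mem_glInt N w _).2 hγ
  obtain ⟨yu, hyu⟩ := (mem_range_map_adicCompletionIntegers_iff_mem_glInt N w _).2 hy
  have hγf : (γu : Matrix (Fin N) (Fin N) (w.adicCompletionIntegers E)).map (w.adicCompletionIntegers E).subtype =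
      ((γw : GL (Fin N) (w.adicCompletion E)) : Matrix (Fin N) (Fin N) (w.adicCompletion E)) :=
    congrArg (fun g : GL (Fin N) (w.adicCompletion E) => (g : Matrix (Fin N) (Fin N) (w.adicCompletion E))) hγu
  have hyf : (yu : Matrix (Fin N) (Fin N) (w.adicCompletionIntegers E)).map (w.adicCompletionIntegers E).subtype =
      ((yw : GL (Fin N) (w.adicCompletion E)) : Matrix (Fin N) (Fin N) (w.adicCompletion E)) :=
    congrArg (fun g : GL (Fin N) (w.adicCompletion E) => (g : Matrix (Fin N) (Fin N) (w.adicCompletion E))) hyu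
  -- the characteristic polynomial of `γ̃` is the separable integral model
  obtain ⟨q, hq, hqsep⟩ := hsep
  have hcharγ : (γu : Matrix (Fin N) (Fin N) (w.adicCompletionIntegers E)).charpoly = q := by
    apply Polynomial.map_injective (w.adicCompletionIntegers E).subtype hfinj
    rw [hq, ← Matrix.charpoly_map, hγf]
  have hsep' : ((γu : Matrix (Fin N) (Fin N) (w.adicCompletionIntegers E)).charpoly.map
      (IsLocalRing.residue (w.adicCompletionIntegers E))).Separable := by
    rw [hcharγ]; exact hqsep
  -- `p_ỹ = p_γ̃` over `𝒪_w` (injectivity of `𝒪_w[X] → E_w[X]`)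
  have hchar' : (yu : Matrix (Fin N) (Fin N) (w.adicCompletionIntegers E)).charpoly =
      (γu : Matrix (Fin N) (Fin N) (w.adicCompletionIntegers E)).charpoly := by
    apply Polynomial.map_injective (w.adicCompletionIntegers E).subtype hfinj
    rw [← Matrix.charpoly_map, ← Matrix.charpoly_map, hγf, hyf, hchar]
  -- ★ F1: an integral conjugator
  obtain ⟨P, hP, hyP⟩ := Literature.LinearAlgebra.Matrix.exists_isUnit_det_conj_of_charpoly_eq _ _ hsep' hchar'
  have hPu : IsUnit P := (Matrix.isUnit_iff_isUnit_det P).2 hP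
  refine ⟨Matrix.GeneralLinearGroup.map (w.adicCompletionIntegers E).subtype hPu.unit,
    (mem_range_map_adicCompletionIntegers_iff_mem_glInt N w _).1 ⟨hPu.unit, rfl⟩, ?_⟩
  rw [mul_inv_eq_iff_eq_mul]
  refine Units.ext ?_
  rw [Units.val_mul, Units.val_mul, ← hγf, ← hyf]
  change (hPu.unit : Matrix (Fin N) (Fin N) (w.adicCompletionIntegers E)).map (w.adicCompletionIntegers E).subtype *
      (γu : Matrix (Fin N) (Fin N) (w.adicCompletionIntegers E)).map (w.adicCompletionIntegers E).subtype =
    (yu : Matrix (Fin N) (Fin N) (w.adicCompletionIntegers E)).map (w.adicCompletionIntegers E).subtype *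
      (hPu.unit : Matrix (Fin N) (Fin N) (w.adicCompletionIntegers E)).map (w.adicCompletionIntegers E).subtype
  rw [IsUnit.unit_spec, ← Matrix.map_mul, ← Matrix.map_mul, hyP]

end GLCore

namespace UnitaryGroup

/-! ## §2 The one-place statements for two integral elements -/

section Local

variable {F E : Type} [Field F] [NumberField F] [Field E] [NumberField E] [Algebra F E]
  (c : E ≃ₐ[F] E) (N : ℕ) (J : Matrix (Fin N) (Fin N) E)

variable [Algebra.IsQuadraticExtension F E] {v : HeightOneSpectrum (𝓞 F)}

/-- **Integral conjugacy of two integral elements at a split place.**  `w ∣ v` split (`c • w ≠ w`), `J` `c`-hermitian with `J_w ∈ GL_N(𝒪_w)`;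
for `g, g′ ∈ U(J)(𝒪_v)` with the same characteristic polynomial (in `GL_N(E ⊗ F_v)`), the one-place image `g_w` (★ `localSplitEquiv`) having an
integral model of its characteristic polynomial separable modulo `𝔪_w`: `k g k⁻¹ = g′` for some `k ∈ U(J)(𝒪_v)` (§1 along ★ `localSplitEquiv`,
levels matched by ★ `mem_localIntegralLevel_iff_of_ne`). [cite: Kottwitz1986, Prop. 7.1] [cite: Rogawski1990, §3.3 p. 21] -/
theorem integralConj_of_split_of_mem (hc : c ≠ 1) (hJh : (J.map c)ᵀ = J) (w : PlacesOver E v) (hw : c • w.1 ≠ w.1)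
    (hJw : IsUnit (placeForm J w.1)) (hJi : hJw.unit ∈ glInt N (w.1.adicCompletion E)) (g g' : «local» E c N J v)
    (hg : g ∈ localIntegralLevel c N J v) (hg' : g' ∈ localIntegralLevel c N J v)
    (hsep : ∃ q : (w.1.adicCompletionIntegers E)[X],
      q.map (w.1.adicCompletionIntegers E).subtype =
          (((localSplitEquiv c J hc hJh w hw hJw g : GL (Fin N) (w.1.adicCompletion E)) :
            Matrix (Fin N) (Fin N) (w.1.adicCompletion E))).charpoly ∧
        (q.map (IsLocalRing.residue (w.1.adicCompletionIntegers E))).Separable)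
    (hchar : (((g' : GL (Fin N) (LocalRing E v)) : Matrix (Fin N) (Fin N) (LocalRing E v))).charpoly =
      (((g : GL (Fin N) (LocalRing E v)) : Matrix (Fin N) (Fin N) (LocalRing E v))).charpoly) :
    ∃ k ∈ localIntegralLevel c N J v, k * g * k⁻¹ = g' := by
  have hcharw : ∀ u : «local» E c N J v, (((localSplitEquiv c J hc hJh w hw hJw u : GL (Fin N) (w.1.adicCompletion E)) :
      Matrix (Fin N) (Fin N) (w.1.adicCompletion E))).charpoly =
      (((u : GL (Fin N) (LocalRing E v)) : Matrix (Fin N) (Fin N) (LocalRing E v))).charpoly.map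
        (Pi.evalRingHom (fun w' : PlacesOver E v => w'.1.adicCompletion E) w) := fun u => by
    rw [coe_localSplitEquiv_apply, Matrix.charpoly_map]
  refine integralConj_of_mulEquiv (localSplitEquiv c J hc hJh w hw hJw).toMulEquiv (localIntegralLevel c N J v) (glInt N (w.1.adicCompletion E))
    (fun u => mem_localIntegralLevel_iff_of_ne c N J hc hJh w hw hJw hJi u) g g' ?_
  change ∃ k' ∈ glInt N (w.1.adicCompletion E),
    k' * localSplitEquiv c J hc hJh w hw hJw g * k'⁻¹ = localSplitEquiv c J hc hJh w hw hJw g'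
  refine exists_mem_glInt_conj_eq_of_charpoly_eq N w.1 _ _ ((mem_localIntegralLevel_iff_of_ne c N J hc hJh w hw hJw hJi g).1 hg)
    ((mem_localIntegralLevel_iff_of_ne c N J hc hJh w hw hJw hJi g').1 hg') hsep ?_
  rw [hcharw, hcharw, hchar]

/-- **Integral conjugacy of two integral elements at an unramified non-split place.**  `w ∣ v` with `c • w = w`, `v` unramified in `E`, `J`
`c`-hermitian with `J_w ∈ GL_N(𝒪_w)`; for `g, g′ ∈ U(J)(𝒪_v)` with the same characteristic polynomial, the one-place image `g_w` (★
`localNonsplitEquiv`) having an integral model of its characteristic polynomial separable modulo `𝔪_w`: `k g k⁻¹ = g′` for some `k ∈ U(J)(𝒪_v)`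
(★ `integralConj_unitaryGroupOfForm`, hypothesis-free, along ★ `localNonsplitEquiv`, levels matched by ★ `mem_localIntegralLevel_iff_of_smul_eq`).
[cite: Kottwitz1986, Prop. 7.1] [cite: Rogawski1990, §3.3 p. 21] -/
theorem integralConj_of_nonsplit_of_mem (hc : c ≠ 1) (hJh : (J.map c)ᵀ = J) (w : PlacesOver E v) (hw : c • w.1 = w.1)
    (hv : Algebra.IsUnramifiedIn (𝓞 E) v.asIdeal) (hJw : IsUnit (placeForm J w.1)) (hJi : hJw.unit ∈ glInt N (w.1.adicCompletion E))
    (g g' : «local» E c N J v) (hg : g ∈ localIntegralLevel c N J v) (hg' : g' ∈ localIntegralLevel c N J v)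
    (hsep : ∃ q : (w.1.adicCompletionIntegers E)[X],
      q.map (w.1.adicCompletionIntegers E).subtype =
          (((localNonsplitEquiv c J hc w hw g : unitaryGroupOfForm (galAdicCompletionMap (L := E) c hw) (placeForm J w.1)) :
            GL (Fin N) (w.1.adicCompletion E)) : Matrix (Fin N) (Fin N) (w.1.adicCompletion E)).charpoly ∧
        (q.map (IsLocalRing.residue (w.1.adicCompletionIntegers E))).Separable)
    (hchar : (((g' : GL (Fin N) (LocalRing E v)) : Matrix (Fin N) (Fin N) (LocalRing E v))).charpoly =
      (((g : GL (Fin N) (LocalRing E v)) : Matrix (Fin N) (Fin N) (LocalRing E v))).charpoly) :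
    ∃ k ∈ localIntegralLevel c N J v, k * g * k⁻¹ = g' := by
  have hcharw : ∀ u : «local» E c N J v,
      ((((localNonsplitEquiv c J hc w hw u : unitaryGroupOfForm (galAdicCompletionMap (L := E) c hw) (placeForm J w.1)) :
        GL (Fin N) (w.1.adicCompletion E)) : Matrix (Fin N) (Fin N) (w.1.adicCompletion E))).charpoly =
      (((u : GL (Fin N) (LocalRing E v)) : Matrix (Fin N) (Fin N) (LocalRing E v))).charpoly.map
        (Pi.evalRingHom (fun w' : PlacesOver E v => w'.1.adicCompletion E) w) := fun u => by
    rw [← Matrix.charpoly_map]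
    rfl
  refine integralConj_of_mulEquiv (localNonsplitEquiv c J hc w hw).toMulEquiv (localIntegralLevel c N J v)
    ((glInt N (w.1.adicCompletion E)).subgroupOf (unitaryGroupOfForm (galAdicCompletionMap (L := E) c hw) (placeForm J w.1)))
    (fun u => by rw [Subgroup.mem_subgroupOf]; exact mem_localIntegralLevel_iff_of_smul_eq c N J hc w hw u) g g' ?_
  refine integralConj_unitaryGroupOfForm c N J hc hJh w hw hv hJw hJi _ ((mem_localIntegralLevel_iff_of_smul_eq c N J hc w hw g).1 hg) hsep _
    ((mem_localIntegralLevel_iff_of_smul_eq c N J hc w hw g').1 hg') ?_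
  change ((((localNonsplitEquiv c J hc w hw g' : unitaryGroupOfForm (galAdicCompletionMap (L := E) c hw) (placeForm J w.1)) :
      GL (Fin N) (w.1.adicCompletion E)) : Matrix (Fin N) (Fin N) (w.1.adicCompletion E))).charpoly =
    ((((localNonsplitEquiv c J hc w hw g : unitaryGroupOfForm (galAdicCompletionMap (L := E) c hw) (placeForm J w.1)) :
      GL (Fin N) (w.1.adicCompletion E)) : Matrix (Fin N) (Fin N) (w.1.adicCompletion E))).charpoly
  rw [hcharw, hcharw, hchar]

end Local

/-! ## §3 Almost every place, the exceptional set depending only on `(J, p)` -/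

section AE

variable {F E : Type} [Field F] [NumberField F] [Field E] [NumberField E] [Algebra F E]
  (c : E ≃ₐ[F] E) (N : ℕ) (J : Matrix (Fin N) (Fin N) E)

/-- Only finitely many places of `F` ramify in `E`: the ramified primes lie below the (finitely many) prime factors of the different
`𝔇_{E/F} ≠ 0` (private copy of ★ `GaloisRepresentations.finite_setOf_not_isUnramifiedIn`, whose module is heavy to import).
[cite: Serre1979, Ch. III §5 Thm. 1] -/
private theorem finite_setOf_not_isUnramifiedIn_aux :
    {v : HeightOneSpectrum (𝓞 F) | ¬ Algebra.IsUnramifiedIn (𝓞 E) v.asIdeal}.Finite := by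
  have hD : differentIdeal (𝓞 F) (𝓞 E) ≠ ⊥ := differentIdeal_ne_bot
  have hfin : {Q : HeightOneSpectrum (𝓞 E) | Q.asIdeal ∣ differentIdeal (𝓞 F) (𝓞 E)}.Finite :=
    Ideal.finite_factors hD
  refine (hfin.image fun Q => Q.under (𝓞 F)).subset ?_
  intro q hq
  simp only [Set.mem_setOf_eq, Algebra.IsUnramifiedIn, not_forall] at hq
  obtain ⟨Q, hQprime, hQover, hQunr⟩ := hq
  haveI := hQprime
  have hQne : Q ≠ ⊥ := Ideal.ne_bot_of_liesOver_of_ne_bot q.ne_bot Q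
  refine ⟨⟨Q, hQprime, hQne⟩, ?_, ?_⟩
  · exact dvd_differentIdeal_iff.mpr hQunr
  · exact HeightOneSpectrum.ext hQover.over.symm

variable [Algebra.IsQuadraticExtension F E]

/-- **Kottwitz's Prop. 7.1, `K_v`-conjugacy form, RELATIVE version at almost every place.**  For `c ≠ 1`, `J` `c`-hermitian with `det J` a unit,
and `p ∈ E[X]` SEPARABLE: for all but finitely many finite places `v` of `F` — off the places ramified in `E`, those with `J_w ∉ GL_N(𝒪_w)` and those
where `p` has no integral model separable modulo `𝔪_w` (★ `eventually_exists_separable_lift`), a set depending only on `(J, p)` — ANY TWO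
`g, g′ ∈ U(J)(𝒪_v)` with `charpoly g = charpoly g′ = p ⊗ 1` (in `GL_N(E ⊗ F_v)`) satisfy `k g k⁻¹ = g′` for some `k ∈ U(J)(𝒪_v)`.  No rational element
of `U(J)` with characteristic polynomial `p` is needed («`γ′_v` is conjugate to `γ` by an element of `K_v` for almost all `v`», for the classes of an
adelic stable class with no rational point). [cite: Kottwitz1986, Prop. 7.1; Cor. 7.3] [cite: Rogawski1990, §3.3 p. 21] -/
theorem eventually_forall_integralConj_of_charpoly_eq (hc : c ≠ 1) (hJh : (J.map c)ᵀ = J) (hJ : IsUnit J.det) (p : E[X]) (hp : p.Separable) :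
    ∀ᶠ v : HeightOneSpectrum (𝓞 F) in cofinite, ∀ g g' : «local» E c N J v, g ∈ localIntegralLevel c N J v → g' ∈ localIntegralLevel c N J v →
      Matrix.charpoly (Units.val (g : GL (Fin N) (LocalRing E v))) = p.map (algebraMap E (LocalRing E v)) →
        Matrix.charpoly (Units.val (g' : GL (Fin N) (LocalRing E v))) = p.map (algebraMap E (LocalRing E v)) →
          ∃ k ∈ localIntegralLevel c N J v, k * g * k⁻¹ = g' := by
  have hJu : IsUnit J := (Matrix.isUnit_iff_isUnit_det J).2 hJ
  filter_upwards [eventually_forall_unit_placeForm_mem_glInt (F := F) N J hJu,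
    eventually_forall_placesOver E (eventually_exists_separable_lift p hp),
    (finite_setOf_not_isUnramifiedIn_aux (F := F) (E := E)).compl_mem_cofinite] with v hint hsep hunr g g' hg hg' hcg hcg'
  have hv : Algebra.IsUnramifiedIn (𝓞 E) v.asIdeal := not_not.1 hunr
  obtain ⟨w⟩ := (inferInstance : Nonempty (PlacesOver E v))
  obtain ⟨q, hq, hqsep⟩ := hsep w
  have hcharw := charpoly_map_evalRingHom_eq_of_charpoly_eq (E := E) N w p (g : GL (Fin N) (LocalRing E v)) hcg
  have hchar : (((g' : GL (Fin N) (LocalRing E v)) : Matrix (Fin N) (Fin N) (LocalRing E v))).charpoly =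
      (((g : GL (Fin N) (LocalRing E v)) : Matrix (Fin N) (Fin N) (LocalRing E v))).charpoly := by
    rw [hcg, hcg']
  by_cases hw : c • w.1 = w.1
  · refine integralConj_of_nonsplit_of_mem c N J hc hJh w hw hv (isUnit_placeForm J hJu w.1) (hint w) g g' hg hg' ⟨q, ?_, hqsep.map⟩ hchar
    rw [coe_coe_localNonsplitEquiv_apply, hcharw]; exact hq
  · refine integralConj_of_split_of_mem c N J hc hJh w hw (isUnit_placeForm J hJu w.1) (hint w) g g' hg hg' ⟨q, ?_, hqsep.map⟩ hchar
    rw [coe_localSplitEquiv_apply, hcharw]; exact hq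

end AE

/-! ## §3b CM dress -/

section CM

variable (L : Type) [Field L] [NumberField L] [IsCMField L] (N : ℕ) (H : Matrix (Fin N) (Fin N) L)

/-- **CM dress of `eventually_forall_integralConj_of_charpoly_eq`** (on ★ `cmDatum`, `K_v` = ★ `cmLocalIntegralLevel`): for `H` hermitian with
`det H ≠ 0` and `p ∈ L[X]` separable, for almost every finite place `v` of `L⁺`, any two `g, g′ ∈ K_v = U(H)(𝒪_v)` with
`charpoly g = charpoly g′ = p ⊗ 1` satisfy `k g k⁻¹ = g′` for some `k ∈ K_v`. [cite: Kottwitz1986, Prop. 7.1; Cor. 7.3] [cite: Rogawski1990, §3.3 p. 21] -/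
theorem eventually_forall_integralConj_cmDatum_of_charpoly_eq (hH : (H.map (cmConjRingHom L))ᵀ = H) (hHd : H.det ≠ 0)
    (p : L[X]) (hp : p.Separable) :
    ∀ᶠ v : HeightOneSpectrum (𝓞 ↥(maximalRealSubfield L)) in cofinite,
      ∀ g g' : (cmDatum L N H).Local v, g ∈ cmLocalIntegralLevel L N H v → g' ∈ cmLocalIntegralLevel L N H v →
        (((g.val : GL (Fin N) (LocalRing L v)) : Matrix (Fin N) (Fin N) (LocalRing L v))).charpoly = p.map (algebraMap L (LocalRing L v)) →
          (((g'.val : GL (Fin N) (LocalRing L v)) : Matrix (Fin N) (Fin N) (LocalRing L v))).charpoly = p.map (algebraMap L (LocalRing L v)) →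
            ∃ k ∈ cmLocalIntegralLevel L N H v, k * g * k⁻¹ = g' :=
  eventually_forall_integralConj_of_charpoly_eq (IsCMField.complexConj L) N H (IsCMField.complexConj_ne_one L) hH (isUnit_iff_ne_zero.2 hHd) p hp

end CM

end UnitaryGroup

end Literature.NumberTheory.Automorphic

end
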